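import Summits.QuantumFields.YangMills.Theorems.BalabanUVNodesN15TwoGridConsistency
import HarnessLib

/-!
# N15 (NE2, η-rate linear theory) — door (iv), part R3-L: block-majorant transfer through the translation-built two-grid operators

Node N15 of the `BalabanUVNodes` DAG is the NE2 η-rate statement (`T4EtaRate.NE2PlusOperator` & co.); door (iv) of its plan
estimates the two-grid defect `𝔇 = G′P − PG` of the propagators by `idef_inv`: `𝔇 = −G′(Δ′P̂₂ − P̂₂Δ)G + (P̂₂ − P)G + …`, where every
operator between the two propagators is `symbOp` of a symbol in the commutative group algebra of the fine torus (parts 34/35/37: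
shifts `s_κ^{±j}`, box filter `a_κ(R)`, partial sums `b̃_κ`, swap symbols `h⁰_ν`, Laplacian-commutator symbols `k_ν`, products `Π a_ν²`).
Part 39 put the (1.110) entries of `G` in `B11SectG.HasMaj` form (block majorants `C·e^{−δ₀ d(y,y′)}` for King's unit blocks on the
carrier `unitTorusGeo L k M`).  This file is the LOCALITY half of R3: it transports such majorants through the symbol operators.

* §18: `j ≤ n` fine steps (`n` = fine points per unit) move King's unit block by at most one unit step
  (`tdistT_blockOf_add_smul_le`, `tdistT_blockOf_sub_smul_le`).
* §19: if `T` has majorant `B·e^{−ρd}` then `ρ(x)∘T` has majorant `F(x)·B·e^{−ρd}` with the explicit factors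
  `F(s^{±j}) = e^{ρ}` (`j ≤ n`), `F(a_κ(R)) = e^{ρ}` (`R ≤ n`), `F(Σ_{i<J}s^i) = J e^{ρ}`, `F(1 + a) = 2e^{ρ}`, `F(b̃(R)) = (R(R−1)/2)e^{ρ}`,
  `F(Π_{s}a²) = e^{2|s|ρ}`, and the two `O(η)` symbols: `F(h⁰_ν(R,c)) = ((R−1)/c)·e^{(2d+4)ρ}` (`hasMaj_sH_comp`),
  `F(k_ν(R,c′)) = (2(R−1)/c′)·e^{(2d+3)ρ}` (`hasMaj_sK_comp`); at the fine lattice `R = L^m`, `c = c′ = L^m·L^k` both prefactors are `≤ 2L^{−k} = 2η`.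
  Tools: `hasMaj_finsum`, `hasMaj_smul_ofBlocks` and n15-c's `VectorPiece.hasMaj_pull_comp`.

All statements are elementary (finite sums, triangle inequality for `tdistT`, `e^{ρ} ≥ 1`); no analytic input. [folklore]; the symbols are those of
[cite: Balaban1984PropagatorsI, (1.31) p.582 (averaging), (1.110) p.604].
-/

noncomputable section

open scoped BigOperators
open Finset

namespace Summit.QuantumFields.YangMills.BalabanUVNodes.N15.TwoGrid

open Literature.MathematicalPhysics.QuantumFieldTheory.Balaban1983to89
open Literature.MathematicalPhysics.QuantumFieldTheory.Balaban1983to89.B11SectG (BlockNorm HasMaj)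
open Literature.MathematicalPhysics.QuantumFieldTheory.Balaban1983to89.B11AxialTransport190 (abs_le_loc_ofBlocks loc_ofBlocks_le)
open Literature.MathematicalPhysics.QuantumFieldTheory.Balaban1983to89.T4EtaRateCoeffDefect (pull pull_apply)
open Literature.MathematicalPhysics.QuantumFieldTheory.Balaban1983to89.B5Prop11Plancherel (Tor fine unitVec)
open Literature.MathematicalPhysics.QuantumFieldTheory.King1986.Torus (blockOf val_blockOf tdistT tdistT_nonneg tdistT_symm tdistT_self tdistT_triangle
  tdistT_sub_unitVec_le)
open Literature.MathematicalPhysics.QuantumFieldTheory.Balaban1983to89.B6UnitTorusCarrier (unitTorusGeo)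
open Summit.QuantumFields.YangMills.BalabanUVNodes.N15.VectorPiece (hasMaj_pull_comp)

variable {d : ℕ}

/-! ## §18 Small translations move King's unit block by at most one -/

section Displacement

variable (M : Fin (d + 1) → ℕ) [∀ μ, NeZero (M μ)] (n : ℕ) [NeZero n]

/-- `j ≤ n` fine steps move the unit block by at most one unit step: `B(x + je_κ) = B(x) + δe_κ`, `δ ∈ {0, 1}`. [cite: King1986, p.664 (blocks B^k(x))] -/
theorem blockOf_add_smul_unitVec_of_le (x : Tor (fine n M)) (κ : Fin (d + 1)) {j : ℕ} (hj : j ≤ n) :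
    ∃ δ : ℕ, δ ≤ 1 ∧ blockOf n M (x + j • unitVec (fine n M) κ) = blockOf n M x + δ • unitVec M κ :=
  floorMap_add_smul_unitVec_of_le (NeZero.ne n) (blockOf n M) (fun x μ => val_blockOf x μ) (fun _ => rfl) x κ hj

/-- … hence `|B(x + je_κ) − B(x)|_T ≤ 1` for `j ≤ n`. [folklore] -/
theorem tdistT_blockOf_add_smul_le (x : Tor (fine n M)) (κ : Fin (d + 1)) {j : ℕ} (hj : j ≤ n) :
    tdistT M (blockOf n M (x + j • unitVec (fine n M) κ)) (blockOf n M x) ≤ 1 := by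
  obtain ⟨δ, hδ, h⟩ := blockOf_add_smul_unitVec_of_le M n x κ hj
  rw [h]
  interval_cases δ
  · rw [zero_smul, add_zero, tdistT_self]; exact zero_le_one
  · rw [one_smul]
    have h1 := tdistT_sub_unitVec_le M (blockOf n M x + unitVec M κ) κ
    rwa [add_sub_cancel_right] at h1

/-- … and backwards: `|B(x − je_κ) − B(x)|_T ≤ 1` for `j ≤ n`. [folklore] -/
theorem tdistT_blockOf_sub_smul_le (x : Tor (fine n M)) (κ : Fin (d + 1)) {j : ℕ} (hj : j ≤ n) :
    tdistT M (blockOf n M (x - j • unitVec (fine n M) κ)) (blockOf n M x) ≤ 1 := by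
  have h := tdistT_blockOf_add_smul_le M n (x - j • unitVec (fine n M) κ) κ hj
  rwa [sub_add_cancel, tdistT_symm] at h

end Displacement

/-! ## §19 Block-majorant transfer through shifts, the box filter, its powers and products, the partial sums, the swap and consistency symbols -/

section Transfer

variable {L : ℕ} (M : Fin (d + 1) → ℕ) [∀ μ, NeZero (M μ)] (k n : ℕ) [NeZero n] {F₁ : Type} [AddCommGroup F₁] [Module ℝ F₁]

/-- **A SHIFT BY `j ≤ n` FINE STEPS COSTS A FACTOR `e^{ρ}`**: if `T` has the block majorant `B·e^{−ρ d}` into the fine 1-forms blocked by King's unit blocks, so does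
`ρ(s_κ^j)∘T` with `B·e^{ρ}`. [folklore] -/
theorem hasMaj_sT_pow_comp {b₁ : BlockNorm (unitTorusGeo L k M) F₁} {T : F₁ →ₗ[ℝ] (Tor (fine n M) × Fin (d + 1) → ℝ)} {B ρ : ℝ}
    (hB : 0 ≤ B) (hρ : 0 ≤ ρ) (κ : Fin (d + 1)) {j : ℕ} (hj : j ≤ n)
    (h : HasMaj b₁ (BlockNorm.ofBlocks (unitTorusGeo L k M) (fun i : Tor (fine n M) × Fin (d + 1) => blockOf n M i.1)) T
      (fun y y' => B * Real.exp (-(ρ * tdistT M y y')))) :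
    HasMaj b₁ (BlockNorm.ofBlocks (unitTorusGeo L k M) (fun i : Tor (fine n M) × Fin (d + 1) => blockOf n M i.1)) (symbOp M n (sT M n κ ^ j) ∘ₗ T)
      (fun y y' => B * Real.exp ρ * Real.exp (-(ρ * tdistT M y y'))) := by
  rw [sT_pow, symbOp_single, one_smul]
  refine hasMaj_pull_comp (g := unitTorusGeo L k M) (fun i : Tor (fine n M) × Fin (d + 1) => blockOf n M i.1)
    (fun i : Tor (fine n M) × Fin (d + 1) => (i.1 + j • unitVec (fine n M) κ, i.2))
    (fun _ _ => mul_nonneg (mul_nonneg hB (Real.exp_nonneg _)) (Real.exp_nonneg _)) (fun i y' => ?_) h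
  show B * Real.exp (-(ρ * tdistT M (blockOf n M (i.1 + j • unitVec (fine n M) κ)) y')) ≤ B * Real.exp ρ * Real.exp (-(ρ * tdistT M (blockOf n M i.1) y'))
  rw [mul_assoc, ← Real.exp_add]
  refine mul_le_mul_of_nonneg_left (Real.exp_le_exp.mpr ?_) hB
  have h1 := tdistT_triangle M (blockOf n M i.1) (blockOf n M (i.1 + j • unitVec (fine n M) κ)) y'
  have h2 : tdistT M (blockOf n M i.1) (blockOf n M (i.1 + j • unitVec (fine n M) κ)) ≤ 1 := by
    rw [tdistT_symm]; exact tdistT_blockOf_add_smul_le M n i.1 κ hj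
  nlinarith

/-- the BACKWARD shift `ρ(s_κ^{−j})∘T`, `j ≤ n`: majorant `B·e^{ρ}`. [folklore] -/
theorem hasMaj_sTinv_pow_comp {b₁ : BlockNorm (unitTorusGeo L k M) F₁} {T : F₁ →ₗ[ℝ] (Tor (fine n M) × Fin (d + 1) → ℝ)} {B ρ : ℝ}
    (hB : 0 ≤ B) (hρ : 0 ≤ ρ) (κ : Fin (d + 1)) {j : ℕ} (hj : j ≤ n)
    (h : HasMaj b₁ (BlockNorm.ofBlocks (unitTorusGeo L k M) (fun i : Tor (fine n M) × Fin (d + 1) => blockOf n M i.1)) T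
      (fun y y' => B * Real.exp (-(ρ * tdistT M y y')))) :
    HasMaj b₁ (BlockNorm.ofBlocks (unitTorusGeo L k M) (fun i : Tor (fine n M) × Fin (d + 1) => blockOf n M i.1)) (symbOp M n (sTinv M n κ ^ j) ∘ₗ T)
      (fun y y' => B * Real.exp ρ * Real.exp (-(ρ * tdistT M y y'))) := by
  rw [sTinv_pow, symbOp_single, one_smul]
  refine hasMaj_pull_comp (g := unitTorusGeo L k M) (fun i : Tor (fine n M) × Fin (d + 1) => blockOf n M i.1)
    (fun i : Tor (fine n M) × Fin (d + 1) => (i.1 + -(j • unitVec (fine n M) κ), i.2))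
    (fun _ _ => mul_nonneg (mul_nonneg hB (Real.exp_nonneg _)) (Real.exp_nonneg _)) (fun i y' => ?_) h
  show B * Real.exp (-(ρ * tdistT M (blockOf n M (i.1 + -(j • unitVec (fine n M) κ))) y')) ≤ B * Real.exp ρ * Real.exp (-(ρ * tdistT M (blockOf n M i.1) y'))
  rw [mul_assoc, ← Real.exp_add, ← sub_eq_add_neg]
  refine mul_le_mul_of_nonneg_left (Real.exp_le_exp.mpr ?_) hB
  have h1 := tdistT_triangle M (blockOf n M i.1) (blockOf n M (i.1 - j • unitVec (fine n M) κ)) y'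
  have h2 : tdistT M (blockOf n M i.1) (blockOf n M (i.1 - j • unitVec (fine n M) κ)) ≤ 1 := by
    rw [tdistT_symm]; exact tdistT_blockOf_sub_smul_le M n i.1 κ hj
  nlinarith

/-- finite sums of operators with a common source space: majorants add (Finset form of `B11SectG.hasMaj_sum`). [folklore] -/
theorem hasMaj_finsum {g : B6.Geometry} {F₂ : Type} [AddCommGroup F₂] [Module ℝ F₂] {b₁ : BlockNorm g F₁} {b₂ : BlockNorm g F₂} {ι : Type}
    (s : Finset ι) (T : ι → F₁ →ₗ[ℝ] F₂) (K : ι → g.Site → g.Site → ℝ) (h : ∀ i ∈ s, HasMaj b₁ b₂ (T i) (K i)) :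
    HasMaj b₁ b₂ (∑ i ∈ s, T i) (fun a b => ∑ i ∈ s, K i a b) := by
  classical
  induction s using Finset.induction_on with
  | empty => simpa using B11SectG.hasMaj_zero b₁ b₂
  | insert i s hi ih =>
      have := (h i (mem_insert_self i s)).add (ih fun i' hi' => h i' (mem_insert_of_mem hi'))
      simpa [sum_insert hi] using this

/-- scalar multiples into the sharp-block sup norm: `c • T` has majorant `|c|·K`. [folklore] -/
theorem hasMaj_smul_ofBlocks {g : B6.Geometry} {X : Type} [Fintype X] {b₁ : BlockNorm g F₁} (blk : X → g.Site) {T : F₁ →ₗ[ℝ] (X → ℝ)}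
    {K : g.Site → g.Site → ℝ} (hK : ∀ y y', 0 ≤ K y y') (c : ℝ) (h : HasMaj b₁ (BlockNorm.ofBlocks g blk) T K) :
    HasMaj b₁ (BlockNorm.ofBlocks g blk) (c • T) (fun y y' => |c| * K y y') := by
  intro y' μ hμ y
  refine loc_ofBlocks_le blk _ (mul_nonneg (mul_nonneg (abs_nonneg c) (hK y y')) (b₁.loc_nonneg y' μ)) fun x hx => ?_
  rw [LinearMap.smul_apply, Pi.smul_apply, smul_eq_mul, abs_mul, mul_assoc]
  exact mul_le_mul_of_nonneg_left ((abs_le_loc_ofBlocks blk _ hx).trans (h y' μ hμ y)) (abs_nonneg c)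

/-- **THE BOX FILTER OF WIDTH `R ≤ n` COSTS A FACTOR `e^{ρ}`**: `ρ(a_κ(R))∘T` keeps the majorant `B·e^{−ρd}` up to `e^{ρ}` (an average of shifts by `< R` fine steps). [folklore] -/
theorem hasMaj_sA_comp {b₁ : BlockNorm (unitTorusGeo L k M) F₁} {T : F₁ →ₗ[ℝ] (Tor (fine n M) × Fin (d + 1) → ℝ)} {B ρ : ℝ}
    (hB : 0 ≤ B) (hρ : 0 ≤ ρ) (κ : Fin (d + 1)) {R : ℕ} (hR : R ≠ 0) (hRn : R ≤ n)
    (h : HasMaj b₁ (BlockNorm.ofBlocks (unitTorusGeo L k M) (fun i : Tor (fine n M) × Fin (d + 1) => blockOf n M i.1)) T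
      (fun y y' => B * Real.exp (-(ρ * tdistT M y y')))) :
    HasMaj b₁ (BlockNorm.ofBlocks (unitTorusGeo L k M) (fun i : Tor (fine n M) × Fin (d + 1) => blockOf n M i.1)) (symbOp M n (sA M n κ R) ∘ₗ T)
      (fun y y' => B * Real.exp ρ * Real.exp (-(ρ * tdistT M y y'))) := by
  have hR' : (0 : ℝ) < R := by exact_mod_cast Nat.pos_of_ne_zero hR
  rw [sA, map_smul, map_sum, LinearMap.smul_comp]
  have h1 : ∀ j ∈ range R, HasMaj b₁ (BlockNorm.ofBlocks (unitTorusGeo L k M) (fun i : Tor (fine n M) × Fin (d + 1) => blockOf n M i.1))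
      (symbOp M n (sT M n κ ^ j) ∘ₗ T) (fun y y' => B * Real.exp ρ * Real.exp (-(ρ * tdistT M y y'))) :=
    fun j hj => hasMaj_sT_pow_comp M k n hB hρ κ ((mem_range.mp hj).le.trans hRn) h
  have hsum := hasMaj_finsum (g := unitTorusGeo L k M) (b₁ := b₁)
    (b₂ := BlockNorm.ofBlocks (unitTorusGeo L k M) (fun i : Tor (fine n M) × Fin (d + 1) => blockOf n M i.1))
    (range R) (fun j => symbOp M n (sT M n κ ^ j) ∘ₗ T) (fun _ y y' => B * Real.exp ρ * Real.exp (-(ρ * tdistT M y y'))) h1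
  refine ((hasMaj_smul_ofBlocks (g := unitTorusGeo L k M) (fun i : Tor (fine n M) × Fin (d + 1) => blockOf n M i.1)
    (fun y y' => sum_nonneg fun j _ => mul_nonneg (mul_nonneg hB (Real.exp_nonneg _)) (Real.exp_nonneg _)) ((R : ℝ)⁻¹)
    (hsum.congr fun μ => ?_)).mono fun y y' => le_of_eq ?_)
  · simp only [LinearMap.sum_apply, LinearMap.comp_apply]
  · show |(R : ℝ)⁻¹| * ∑ j ∈ range R, B * Real.exp ρ * Real.exp (-(ρ * tdistT M y y')) = _
    rw [sum_const, card_range, nsmul_eq_mul, abs_inv, Nat.abs_cast, ← mul_assoc, inv_mul_cancel₀ hR'.ne', one_mul]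

/-- `ρ(Σ_{i<J} s_κ^i)∘T`, `J ≤ n`: majorant `J·B·e^{ρ}`. [folklore] -/
theorem hasMaj_sum_sT_pow_comp {b₁ : BlockNorm (unitTorusGeo L k M) F₁} {T : F₁ →ₗ[ℝ] (Tor (fine n M) × Fin (d + 1) → ℝ)} {B ρ : ℝ}
    (hB : 0 ≤ B) (hρ : 0 ≤ ρ) (κ : Fin (d + 1)) {J : ℕ} (hJn : J ≤ n)
    (h : HasMaj b₁ (BlockNorm.ofBlocks (unitTorusGeo L k M) (fun i : Tor (fine n M) × Fin (d + 1) => blockOf n M i.1)) T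
      (fun y y' => B * Real.exp (-(ρ * tdistT M y y')))) :
    HasMaj b₁ (BlockNorm.ofBlocks (unitTorusGeo L k M) (fun i : Tor (fine n M) × Fin (d + 1) => blockOf n M i.1))
      (symbOp M n (∑ i ∈ range J, sT M n κ ^ i) ∘ₗ T) (fun y y' => (J : ℝ) * (B * Real.exp ρ * Real.exp (-(ρ * tdistT M y y')))) := by
  rw [map_sum]
  have h2 : ∀ i ∈ range J, HasMaj b₁ (BlockNorm.ofBlocks (unitTorusGeo L k M) (fun i : Tor (fine n M) × Fin (d + 1) => blockOf n M i.1))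
      (symbOp M n (sT M n κ ^ i) ∘ₗ T) (fun y y' => B * Real.exp ρ * Real.exp (-(ρ * tdistT M y y'))) :=
    fun i hi => hasMaj_sT_pow_comp M k n hB hρ κ ((mem_range.mp hi).le.trans hJn) h
  have hs := hasMaj_finsum (g := unitTorusGeo L k M) (b₁ := b₁)
    (b₂ := BlockNorm.ofBlocks (unitTorusGeo L k M) (fun i : Tor (fine n M) × Fin (d + 1) => blockOf n M i.1))
    (range J) (fun i => symbOp M n (sT M n κ ^ i) ∘ₗ T) (fun _ y y' => B * Real.exp ρ * Real.exp (-(ρ * tdistT M y y'))) h2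
  refine (hs.congr fun μ => ?_).mono fun y y' => le_of_eq ?_
  · simp only [LinearMap.sum_apply, LinearMap.comp_apply]
  · show ∑ i ∈ range J, B * Real.exp ρ * Real.exp (-(ρ * tdistT M y y')) = _
    rw [sum_const, card_range, nsmul_eq_mul]

/-- `ρ(1 + a_κ(R))∘T`: majorant `2B·e^{ρ}`. [folklore] -/
theorem hasMaj_one_add_sA_comp {b₁ : BlockNorm (unitTorusGeo L k M) F₁} {T : F₁ →ₗ[ℝ] (Tor (fine n M) × Fin (d + 1) → ℝ)} {B ρ : ℝ}
    (hB : 0 ≤ B) (hρ : 0 ≤ ρ) (κ : Fin (d + 1)) {R : ℕ} (hR : R ≠ 0) (hRn : R ≤ n)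
    (h : HasMaj b₁ (BlockNorm.ofBlocks (unitTorusGeo L k M) (fun i : Tor (fine n M) × Fin (d + 1) => blockOf n M i.1)) T
      (fun y y' => B * Real.exp (-(ρ * tdistT M y y')))) :
    HasMaj b₁ (BlockNorm.ofBlocks (unitTorusGeo L k M) (fun i : Tor (fine n M) × Fin (d + 1) => blockOf n M i.1)) (symbOp M n (1 + sA M n κ R) ∘ₗ T)
      (fun y y' => 2 * B * Real.exp ρ * Real.exp (-(ρ * tdistT M y y'))) := by
  rw [map_add, map_one, LinearMap.add_comp, Module.End.one_eq_id, LinearMap.id_comp]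
  refine (h.add (hasMaj_sA_comp M k n hB hρ κ hR hRn h)).mono fun y y' => ?_
  show B * Real.exp (-(ρ * tdistT M y y')) + B * Real.exp ρ * Real.exp (-(ρ * tdistT M y y')) ≤ _
  have h1 : B * Real.exp (-(ρ * tdistT M y y')) ≤ B * Real.exp ρ * Real.exp (-(ρ * tdistT M y y')) :=
    mul_le_mul_of_nonneg_right (le_mul_of_one_le_right hB (Real.one_le_exp hρ)) (Real.exp_nonneg _)
  linarith

/-- `ρ(b̃_κ(R))∘T` (`b̃ = Σ_{j<R}Σ_{i<j}s^i`, `R ≤ n`): majorant `(R(R−1)/2)·B·e^{ρ}`. [folklore] -/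
theorem hasMaj_sBt_comp {b₁ : BlockNorm (unitTorusGeo L k M) F₁} {T : F₁ →ₗ[ℝ] (Tor (fine n M) × Fin (d + 1) → ℝ)} {B ρ : ℝ}
    (hB : 0 ≤ B) (hρ : 0 ≤ ρ) (κ : Fin (d + 1)) {R : ℕ} (hRn : R ≤ n)
    (h : HasMaj b₁ (BlockNorm.ofBlocks (unitTorusGeo L k M) (fun i : Tor (fine n M) × Fin (d + 1) => blockOf n M i.1)) T
      (fun y y' => B * Real.exp (-(ρ * tdistT M y y')))) :
    HasMaj b₁ (BlockNorm.ofBlocks (unitTorusGeo L k M) (fun i : Tor (fine n M) × Fin (d + 1) => blockOf n M i.1)) (symbOp M n (sBt M n κ R) ∘ₗ T)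
      (fun y y' => (R : ℝ) * ((R : ℝ) - 1) / 2 * (B * Real.exp ρ * Real.exp (-(ρ * tdistT M y y')))) := by
  rw [sBt, map_sum]
  have h1 : ∀ j ∈ range R, HasMaj b₁ (BlockNorm.ofBlocks (unitTorusGeo L k M) (fun i : Tor (fine n M) × Fin (d + 1) => blockOf n M i.1))
      (symbOp M n (∑ i ∈ range j, sT M n κ ^ i) ∘ₗ T) (fun y y' => (j : ℝ) * (B * Real.exp ρ * Real.exp (-(ρ * tdistT M y y')))) :=
    fun j hj => hasMaj_sum_sT_pow_comp M k n hB hρ κ ((mem_range.mp hj).le.trans hRn) h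
  have hs := hasMaj_finsum (g := unitTorusGeo L k M) (b₁ := b₁)
    (b₂ := BlockNorm.ofBlocks (unitTorusGeo L k M) (fun i : Tor (fine n M) × Fin (d + 1) => blockOf n M i.1))
    (range R) (fun j => symbOp M n (∑ i ∈ range j, sT M n κ ^ i) ∘ₗ T)
    (fun j y y' => (j : ℝ) * (B * Real.exp ρ * Real.exp (-(ρ * tdistT M y y')))) h1
  refine (hs.congr fun μ => ?_).mono fun y y' => le_of_eq ?_
  · simp only [LinearMap.sum_apply, LinearMap.comp_apply]
  · show ∑ j ∈ range R, (j : ℝ) * (B * Real.exp ρ * Real.exp (-(ρ * tdistT M y y'))) = _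
    rw [← sum_mul, sum_range_cast_eq]

/-- `ρ(Π_{ν∈s} a_ν(R)²)∘T`: majorant `B·e^{2|s|ρ}`. [folklore] -/
theorem hasMaj_prod_sA_sq_comp {b₁ : BlockNorm (unitTorusGeo L k M) F₁} {B ρ : ℝ} (hB : 0 ≤ B) (hρ : 0 ≤ ρ) {R : ℕ} (hR : R ≠ 0) (hRn : R ≤ n)
    (s : Finset (Fin (d + 1))) {T : F₁ →ₗ[ℝ] (Tor (fine n M) × Fin (d + 1) → ℝ)}
    (h : HasMaj b₁ (BlockNorm.ofBlocks (unitTorusGeo L k M) (fun i : Tor (fine n M) × Fin (d + 1) => blockOf n M i.1)) T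
      (fun y y' => B * Real.exp (-(ρ * tdistT M y y')))) :
    HasMaj b₁ (BlockNorm.ofBlocks (unitTorusGeo L k M) (fun i : Tor (fine n M) × Fin (d + 1) => blockOf n M i.1))
      (symbOp M n (∏ ν ∈ s, sA M n ν R ^ 2) ∘ₗ T) (fun y y' => B * Real.exp ρ ^ (2 * s.card) * Real.exp (-(ρ * tdistT M y y'))) := by
  classical
  induction s using Finset.induction_on with
  | empty =>
      rw [prod_empty, map_one, Module.End.one_eq_id, LinearMap.id_comp]
      exact h.mono fun y y' => by rw [card_empty, mul_zero, pow_zero, mul_one]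
  | insert ν s hν ih =>
      rw [prod_insert hν, map_mul, map_pow, pow_two, Module.End.mul_eq_comp, Module.End.mul_eq_comp, LinearMap.comp_assoc, LinearMap.comp_assoc]
      have hB' : 0 ≤ B * Real.exp ρ ^ (2 * s.card) := mul_nonneg hB (pow_nonneg (Real.exp_nonneg _) _)
      have h1 := hasMaj_sA_comp M k n hB' hρ ν hR hRn ih
      have h2 := hasMaj_sA_comp M k n (mul_nonneg hB' (Real.exp_nonneg _)) hρ ν hR hRn h1
      refine h2.mono fun y y' => le_of_eq ?_
      rw [card_insert_of_notMem hν]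
      ring

/-- **THE SWAP SYMBOL IS `O(η)` IN BLOCK-MAJORANT FORM**: `ρ(h⁰_ν)∘T` has the majorant `((R−1)/c)·B·e^{(2d+4)ρ}·e^{−ρd}` (for `R ≤ n`, `c > 0`; at the
fine lattice `c = L^m·L^k`, `R = L^m` the prefactor is `≤ L^{−k} = η`). [folklore] -/
theorem hasMaj_sH_comp {b₁ : BlockNorm (unitTorusGeo L k M) F₁} {T : F₁ →ₗ[ℝ] (Tor (fine n M) × Fin (d + 1) → ℝ)} {B ρ : ℝ}
    (hB : 0 ≤ B) (hρ : 0 ≤ ρ) {R : ℕ} (hR : R ≠ 0) (hRn : R ≤ n) {c : ℝ} (hc : 0 < c) (ν : Fin (d + 1))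
    (h : HasMaj b₁ (BlockNorm.ofBlocks (unitTorusGeo L k M) (fun i : Tor (fine n M) × Fin (d + 1) => blockOf n M i.1)) T
      (fun y y' => B * Real.exp (-(ρ * tdistT M y y')))) :
    HasMaj b₁ (BlockNorm.ofBlocks (unitTorusGeo L k M) (fun i : Tor (fine n M) × Fin (d + 1) => blockOf n M i.1)) (symbOp M n (sH M n R c ν) ∘ₗ T)
      (fun y y' => ((R : ℝ) - 1) / c * (B * Real.exp ρ ^ (2 * d + 4) * Real.exp (-(ρ * tdistT M y y')))) := by
  classical
  have hR' : (0 : ℝ) < R := by exact_mod_cast Nat.pos_of_ne_zero hR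
  have hR1 : (0 : ℝ) ≤ (R : ℝ) - 1 := by
    have : (1 : ℝ) ≤ R := by exact_mod_cast Nat.one_le_iff_ne_zero.mpr hR
    linarith
  rw [sH, map_neg, LinearMap.neg_comp, map_smul, LinearMap.smul_comp]
  simp only [map_mul, Module.End.mul_eq_comp, LinearMap.comp_assoc]
  set s : Finset (Fin (d + 1)) := univ.filter (· < ν) with hs
  have hP := hasMaj_prod_sA_sq_comp M k n hB hρ hR hRn s h
  have hB' : 0 ≤ B * Real.exp ρ ^ (2 * s.card) := mul_nonneg hB (pow_nonneg (Real.exp_nonneg _) _)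
  have h1A := hasMaj_one_add_sA_comp M k n hB' hρ ν hR hRn hP
  have hBt := hasMaj_sBt_comp M k n (B := 2 * (B * Real.exp ρ ^ (2 * s.card)) * Real.exp ρ)
    (mul_nonneg (mul_nonneg zero_le_two hB') (Real.exp_nonneg _)) hρ ν hRn h1A
  have hsm := hasMaj_smul_ofBlocks (g := unitTorusGeo L k M) (fun i : Tor (fine n M) × Fin (d + 1) => blockOf n M i.1)
    (fun y y' => mul_nonneg (div_nonneg (mul_nonneg hR'.le hR1) zero_le_two) (mul_nonneg (mul_nonneg
      (mul_nonneg (mul_nonneg zero_le_two hB') (Real.exp_nonneg _)) (Real.exp_nonneg _)) (Real.exp_nonneg _))) ((c * R)⁻¹) hBt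
  refine hsm.neg.mono fun y y' => ?_
  have hcard : s.card ≤ d + 1 := (card_filter_le _ _).trans (by rw [card_univ, Fintype.card_fin])
  have he : Real.exp ρ ^ (2 * s.card) * Real.exp ρ * Real.exp ρ ≤ Real.exp ρ ^ (2 * d + 4) := by
    rw [← pow_succ, ← pow_succ]
    exact pow_le_pow_right₀ (Real.one_le_exp hρ) (by omega)
  have hE := Real.exp_nonneg (-(ρ * tdistT M y y'))
  calc |(c * (R : ℝ))⁻¹| * ((R : ℝ) * ((R : ℝ) - 1) / 2 * (2 * (B * Real.exp ρ ^ (2 * s.card)) * Real.exp ρ * Real.exp ρ * Real.exp (-(ρ * tdistT M y y'))))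
      = ((R : ℝ) - 1) / c * (B * (Real.exp ρ ^ (2 * s.card) * Real.exp ρ * Real.exp ρ) * Real.exp (-(ρ * tdistT M y y'))) := by
        rw [abs_inv, abs_of_pos (mul_pos hc hR')]
        field_simp
    _ ≤ ((R : ℝ) - 1) / c * (B * Real.exp ρ ^ (2 * d + 4) * Real.exp (-(ρ * tdistT M y y'))) :=
        mul_le_mul_of_nonneg_left (mul_le_mul_of_nonneg_right (mul_le_mul_of_nonneg_left he hB) hE) (div_nonneg hR1 hc.le)

/-- **THE LAPLACIAN-COMMUTATOR SYMBOL `k_ν` IS `O(η)` IN BLOCK-MAJORANT FORM**: `ρ(k_ν(R, c′))∘T` has the majorant `(2(R−1)/c′)·B·e^{(2d+3)ρ}·e^{−ρd}`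
(`R ≤ n`, `c′ > 0`; at the fine lattice `c′ = L^m·L^k`, `R = L^m`: prefactor `≤ 2L^{−k} = 2η`; cf. the sup-norm bound `norm_symbOp_sK_fine_le` of part 35). [folklore] -/
theorem hasMaj_sK_comp {b₁ : BlockNorm (unitTorusGeo L k M) F₁} {T : F₁ →ₗ[ℝ] (Tor (fine n M) × Fin (d + 1) → ℝ)} {B ρ : ℝ}
    (hB : 0 ≤ B) (hρ : 0 ≤ ρ) {R : ℕ} (hR : R ≠ 0) (hRn : R ≤ n) {c' : ℝ} (hc : 0 < c') (ν : Fin (d + 1))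
    (h : HasMaj b₁ (BlockNorm.ofBlocks (unitTorusGeo L k M) (fun i : Tor (fine n M) × Fin (d + 1) => blockOf n M i.1)) T
      (fun y y' => B * Real.exp (-(ρ * tdistT M y y')))) :
    HasMaj b₁ (BlockNorm.ofBlocks (unitTorusGeo L k M) (fun i : Tor (fine n M) × Fin (d + 1) => blockOf n M i.1)) (symbOp M n (sK M n ν R c') ∘ₗ T)
      (fun y y' => 2 * ((R : ℝ) - 1) / c' * (B * Real.exp ρ ^ (2 * d + 3) * Real.exp (-(ρ * tdistT M y y')))) := by
  classical
  have hR' : (0 : ℝ) < R := by exact_mod_cast Nat.pos_of_ne_zero hR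
  have hR1 : (0 : ℝ) ≤ (R : ℝ) - 1 := by
    have : (1 : ℝ) ≤ R := by exact_mod_cast Nat.one_le_iff_ne_zero.mpr hR
    linarith
  have hcast : (((R - 1 : ℕ) : ℝ)) = (R : ℝ) - 1 := by rw [Nat.cast_sub (Nat.one_le_iff_ne_zero.mpr hR), Nat.cast_one]
  rw [sK]
  simp only [map_sub, map_smul, map_mul, LinearMap.sub_comp, LinearMap.smul_comp, Module.End.mul_eq_comp, LinearMap.comp_assoc]
  set s : Finset (Fin (d + 1)) := univ.erase ν with hs
  have hcard : s.card = d := by rw [hs, card_erase_of_mem (mem_univ ν), card_univ, Fintype.card_fin, Nat.add_sub_cancel]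
  have hU := hasMaj_prod_sA_sq_comp M k n hB hρ hR hRn s h
  set B₁ : ℝ := B * Real.exp ρ ^ (2 * s.card) with hB₁
  have hB₁' : 0 ≤ B₁ := mul_nonneg hB (pow_nonneg (Real.exp_nonneg _) _)
  have he1 : 1 ≤ Real.exp ρ := Real.one_le_exp hρ
  have h1A := hasMaj_one_add_sA_comp M k n hB₁' hρ ν hR hRn hU
  have hBt := hasMaj_sBt_comp M k n (B := 2 * B₁ * Real.exp ρ) (mul_nonneg (mul_nonneg zero_le_two hB₁') (Real.exp_nonneg _)) hρ ν hRn h1A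
  have hsm := hasMaj_smul_ofBlocks (g := unitTorusGeo L k M) (fun i : Tor (fine n M) × Fin (d + 1) => blockOf n M i.1)
    (fun y y' => mul_nonneg (div_nonneg (mul_nonneg hR'.le hR1) zero_le_two) (mul_nonneg (mul_nonneg
      (mul_nonneg (mul_nonneg zero_le_two hB₁') (Real.exp_nonneg _)) (Real.exp_nonneg _)) (Real.exp_nonneg _))) ((R : ℝ)⁻¹) hBt
  have hSum := hasMaj_sum_sT_pow_comp M k n hB₁' hρ ν ((Nat.sub_le R 1).trans hRn) hU
  have hdiff := (hsm.sub hSum).mono (K' := fun y y' => 2 * ((R : ℝ) - 1) * B₁ * Real.exp ρ * Real.exp ρ * Real.exp (-(ρ * tdistT M y y')))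
    fun y y' => by
      have hE := Real.exp_nonneg (-(ρ * tdistT M y y'))
      show |(R : ℝ)⁻¹| * ((R : ℝ) * ((R : ℝ) - 1) / 2 * (2 * B₁ * Real.exp ρ * Real.exp ρ * Real.exp (-(ρ * tdistT M y y'))))
        + ((R - 1 : ℕ) : ℝ) * (B₁ * Real.exp ρ * Real.exp (-(ρ * tdistT M y y'))) ≤ _
      rw [abs_inv, Nat.abs_cast, hcast]
      have h3 : ((R : ℝ) - 1) * (B₁ * Real.exp ρ * Real.exp (-(ρ * tdistT M y y')))
          ≤ ((R : ℝ) - 1) * (B₁ * Real.exp ρ * Real.exp ρ * Real.exp (-(ρ * tdistT M y y'))) :=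
        mul_le_mul_of_nonneg_left (mul_le_mul_of_nonneg_right (le_mul_of_one_le_right (mul_nonneg hB₁' (Real.exp_nonneg _)) he1) hE) hR1
      have h4 : (R : ℝ)⁻¹ * ((R : ℝ) * ((R : ℝ) - 1) / 2 * (2 * B₁ * Real.exp ρ * Real.exp ρ * Real.exp (-(ρ * tdistT M y y'))))
          = ((R : ℝ) - 1) * (B₁ * Real.exp ρ * Real.exp ρ * Real.exp (-(ρ * tdistT M y y'))) := by
        field_simp
      rw [h4]
      linarith
  have hTi := hasMaj_sTinv_pow_comp M k n (B := 2 * ((R : ℝ) - 1) * B₁ * Real.exp ρ * Real.exp ρ)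
    (mul_nonneg (mul_nonneg (mul_nonneg (mul_nonneg zero_le_two hR1) hB₁') (Real.exp_nonneg _)) (Real.exp_nonneg _)) hρ ν hRn hdiff
  have hout := hasMaj_smul_ofBlocks (g := unitTorusGeo L k M) (fun i : Tor (fine n M) × Fin (d + 1) => blockOf n M i.1)
    (fun y y' => mul_nonneg (mul_nonneg (mul_nonneg (mul_nonneg (mul_nonneg (mul_nonneg zero_le_two hR1) hB₁') (Real.exp_nonneg _))
      (Real.exp_nonneg _)) (Real.exp_nonneg _)) (Real.exp_nonneg _)) (c'⁻¹) hTi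
  refine hout.mono fun y y' => le_of_eq ?_
  show |c'⁻¹| * (2 * ((R : ℝ) - 1) * B₁ * Real.exp ρ * Real.exp ρ * Real.exp ρ * Real.exp (-(ρ * tdistT M y y'))) = _
  rw [abs_inv, abs_of_pos hc, hB₁, hcard, show 2 * d + 3 = 2 * d + 1 + 1 + 1 by ring, pow_succ, pow_succ, pow_succ]
  field_simp

end Transfer

end Summit.QuantumFields.YangMills.BalabanUVNodes.N15.TwoGrid
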